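import Literature.Geometry.Riemannian.SphericalCylinderEntropy
import Mathlib.Analysis.SpecificLimits.Normed
import Mathlib.Analysis.Complex.Exponential
import HarnessLib

/-!
# The zonal heat-kernel series of `S⁴` and `S⁶`: summability for all positive times

The typed zonal kernel of `Literature.Geometry.Riemannian.SphericalCylinderEntropy` is
`zonal τ s = ∑' k, wt k τ * gegen k s = ∑_k e^{-k(k+3)τ} (2k+3)/3 · C_k^{(3/2)}(s)`
(`vol(S⁴)` times the heat kernel of the round `S⁴` at time `τ`, as a function of
`s = cos(geodesic distance)`; the Gegenbauer polynomial `C_k^{(3/2)}` is the explicit finite sum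
DLMF 18.5.10 = Andrews–Askey–Roy (6.4.11)).  That file proves summability only for `τ ≥ 1` and
`|s| ≤ 1`.  Here we introduce the `S⁶` analogues

* `gegenSix j s = C_j^{(5/2)}(s)` (explicit finite sum), `wtSix j τ = e^{-j(j+5)τ} (2j+5)/5`,
  `zonalSix τ s = ∑' j, wtSix j τ * gegenSix j s` (`vol(S⁶)` times the heat kernel of the round
  `S⁶`: eigenvalues `j(j+5)`, zonal harmonics `(2j+5)/5 · C_j^{(5/2)}`),

which carry the `s`-derivative of `zonal` (`∂_s zonal τ s = 5 e^{-4τ} zonalSix τ s`, proved in the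
sequel `SphericalZonalKernelSeriesDeriv.lean` from `d/ds C_{j+1}^{(3/2)} = 3 C_j^{(5/2)}`), and prove,
for every `τ > 0` and every real `s`:

* `abs_gegen_le_of_abs_le`, `abs_gegenSix_le_of_abs_le` — crude bounds
  `|C_k^{(3/2)}(s)| ≤ (k+1)(k+1)!(2R)^k`, `|C_j^{(5/2)}(s)| ≤ (j+1)(j+2)!(2R)^j` on `|s| ≤ R`;
* `summable_majorant` — `∑_k e^{-k²τ} ((k+3)!)² c^k < ∞` (ratio test: the Gaussian factor
  `e^{-(2k+1)τ}` of consecutive terms beats the polynomial ratio `c (k+4)²`,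
  `eventually_ratio_le_half`);
* `norm_wt_mul_gegen_le`, `norm_wt_succ_mul_gegenSix_le`, `norm_wtSix_mul_gegenSix_le` — the terms of
  the `S⁴` series, of its derivative series and of the `S⁶` series are dominated by that majorant
  on `|s| ≤ R` (uniform bounds, as needed for `continuousOn_tsum` / `hasDerivAt_tsum_of_isPreconnected`);
* `summable_wt_mul_gegen`, `summable_wtSix_mul_gegenSix` — **absolute convergence of both zonal
  series for every `τ > 0` and every real `s`**;
* `wt_succ_mul_three` — the weight bookkeeping `3 wt (j+1) τ = 5 e^{-4τ} wtSix j τ`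
  (`(j+1)(j+4) = j(j+5) + 4`).

Everything here is proved; no named facts are introduced.  The sequels
`SphericalZonalKernelSeriesDeriv.lean` (term-wise derivative, reduction of the monotonicity of
`zonal` to `zonalSix ≥ 0`), `SphericalZonalSixDuality.lean` and `SphericalZonalSixPositivity.lean`
(`zonalSix ≥ 0`, hence `monotoneOn_zonal`) complete the proof that the typed `S⁴` kernel is monotone
in `s` (stub `zonalMonotone` of the line `ball-mass-slack` of `SmoothPoincare4/CylinderEntropy`).

## References
* G. E. Andrews, R. Askey, R. Roy, *Special Functions*, CUP 1999, §6.4 ((6.4.11)) and §9.6.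
* E. B. Davies, *Heat Kernels and Spectral Theory*, CUP 1989, Ch. 5 (heat kernels of compact
  manifolds and their eigenfunction expansions).
* NIST DLMF 18.5.10.
-/

noncomputable section

open scoped BigOperators Topology Nat
open Filter Set Literature.Geometry.Riemannian.SphericalCylinderEntropy

namespace Literature.Geometry.Riemannian.SphericalZonalKernelSeries

/-! ### The `S⁶` objects -/

/-- The Gegenbauer polynomial `C_j^{(5/2)}(s)` as its explicit finite sum
`∑_{l ≤ j/2} (-1)^l (5/2)_{j-l} / (l! (j-2l)!) (2s)^{j-2l}` (AAR (6.4.11), DLMF 18.5.10). [folklore] -/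
def gegenSix (j : ℕ) (s : ℝ) : ℝ :=
  ∑ l ∈ Finset.range (j / 2 + 1), (-1 : ℝ) ^ l *
    (∏ i ∈ Finset.range (j - l), ((5 : ℝ) / 2 + (i : ℝ))) /
      (((l.factorial : ℕ) : ℝ) * (((j - 2 * l).factorial : ℕ) : ℝ)) * (2 * s) ^ (j - 2 * l)

/-- The `S⁶` heat weights `e^{-j(j+5)τ} (2j+5)/5` (eigenvalue `j(j+5)` of degree-`j` spherical
harmonics on `S⁶`, multiplicity over `C_j^{(5/2)}(1)` equal to `(2j+5)/5`). [folklore] -/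
def wtSix (j : ℕ) (τ : ℝ) : ℝ :=
  Real.exp (-((j : ℝ) * ((j : ℝ) + 5)) * τ) * ((2 * (j : ℝ) + 5) / 5)

/-- The zonal series `∑_j e^{-j(j+5)τ} (2j+5)/5 · C_j^{(5/2)}(s)`: `vol(S⁶)` times the heat kernel
of the round `S⁶` at time `τ`, as a function of the cosine `s` of the geodesic distance. [folklore] -/
def zonalSix (τ s : ℝ) : ℝ := ∑' j : ℕ, wtSix j τ * gegenSix j s

/-- `C_0^{(5/2)} = 1`. [folklore] -/
@[simp] theorem gegenSix_zero (s : ℝ) : gegenSix 0 s = 1 := by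
  simp [gegenSix]

/-- The `S⁶` weights are positive. [folklore] -/
theorem wtSix_pos (j : ℕ) (τ : ℝ) : 0 < wtSix j τ := by
  unfold wtSix; positivity

/-! ### Crude bounds on the Gegenbauer sums on `|s| ≤ R` -/

/-- The Pochhammer product `(5/2)_n` is non-negative. [folklore] -/
theorem prod_fiveHalves_nonneg (n : ℕ) : 0 ≤ ∏ i ∈ Finset.range n, ((5 : ℝ) / 2 + (i : ℝ)) :=
  Finset.prod_nonneg fun i _ => by positivity

/-- `(5/2)_n ≤ (n+2)!`. [folklore] -/
theorem prod_fiveHalves_le (n : ℕ) :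
    ∏ i ∈ Finset.range n, ((5 : ℝ) / 2 + (i : ℝ)) ≤ ((n + 2).factorial : ℝ) := by
  induction n with
  | zero => norm_num [Nat.factorial]
  | succ n ih =>
    rw [Finset.prod_range_succ, Nat.factorial_succ (n + 2), Nat.cast_mul]
    have h1 : (5 : ℝ) / 2 + (n : ℝ) ≤ ((n + 2 + 1 : ℕ) : ℝ) := by push_cast; linarith
    calc (∏ i ∈ Finset.range n, ((5 : ℝ) / 2 + (i : ℝ))) * ((5 : ℝ) / 2 + (n : ℝ))
        ≤ ((n + 2).factorial : ℝ) * ((n + 2 + 1 : ℕ) : ℝ) :=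
          mul_le_mul ih h1 (by positivity) (by positivity)
      _ = ((n + 2 + 1 : ℕ) : ℝ) * ((n + 2).factorial : ℝ) := by ring

/-- `|C_k^{(3/2)}(s)| ≤ (k+1) (k+1)! (2R)^k` for `|s| ≤ R`, `R ≥ 1`. [folklore] -/
theorem abs_gegen_le_of_abs_le (k : ℕ) {s R : ℝ} (hR : 1 ≤ R) (hs : |s| ≤ R) :
    |gegen k s| ≤ ((k : ℝ) + 1) * ((k + 1).factorial : ℝ) * (2 * R) ^ k := by
  unfold gegen
  refine (Finset.abs_sum_le_sum_abs _ _).trans ?_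
  have hterm : ∀ l ∈ Finset.range (k / 2 + 1),
      |(-1 : ℝ) ^ l * (∏ j ∈ Finset.range (k - l), ((3 : ℝ) / 2 + (j : ℝ))) /
        (((l.factorial : ℕ) : ℝ) * (((k - 2 * l).factorial : ℕ) : ℝ)) * (2 * s) ^ (k - 2 * l)|
        ≤ ((k + 1).factorial : ℝ) * (2 * R) ^ k := by
    intro l _
    rw [abs_mul, abs_div, abs_mul, abs_pow, abs_neg, abs_one, one_pow, one_mul,
      abs_of_nonneg (prod_threeHalves_nonneg _), abs_pow,
      abs_of_pos (show (0 : ℝ) < ((l.factorial : ℕ) : ℝ) * (((k - 2 * l).factorial : ℕ) : ℝ) by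
        positivity)]
    have hP : (∏ j ∈ Finset.range (k - l), ((3 : ℝ) / 2 + (j : ℝ))) ≤ ((k + 1).factorial : ℝ) :=
      (prod_threeHalves_le _).trans (by exact_mod_cast Nat.factorial_le (by omega))
    have hden : (1 : ℝ) ≤ ((l.factorial : ℕ) : ℝ) * (((k - 2 * l).factorial : ℕ) : ℝ) := by
      have h1 : (1 : ℝ) ≤ ((l.factorial : ℕ) : ℝ) := by exact_mod_cast Nat.factorial_pos l
      have h2 : (1 : ℝ) ≤ (((k - 2 * l).factorial : ℕ) : ℝ) := by exact_mod_cast Nat.factorial_pos _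
      nlinarith
    have hpow : |2 * s| ^ (k - 2 * l) ≤ (2 * R) ^ k := by
      have h2s : |2 * s| ≤ 2 * R := by rw [abs_mul, abs_two]; linarith
      calc |2 * s| ^ (k - 2 * l) ≤ (2 * R) ^ (k - 2 * l) :=
            pow_le_pow_left₀ (abs_nonneg _) h2s _
        _ ≤ (2 * R) ^ k := pow_le_pow_right₀ (by linarith) (by omega)
    calc (∏ j ∈ Finset.range (k - l), ((3 : ℝ) / 2 + (j : ℝ))) /
          (((l.factorial : ℕ) : ℝ) * (((k - 2 * l).factorial : ℕ) : ℝ)) * |2 * s| ^ (k - 2 * l)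
        ≤ ((k + 1).factorial : ℝ) / 1 * (2 * R) ^ k := by
          refine mul_le_mul (div_le_div₀ (by positivity) hP one_pos hden) hpow (by positivity)
            (by positivity)
      _ = ((k + 1).factorial : ℝ) * (2 * R) ^ k := by rw [div_one]
  refine (Finset.sum_le_sum hterm).trans ?_
  rw [Finset.sum_const, Finset.card_range, nsmul_eq_mul]
  have hk : ((k / 2 + 1 : ℕ) : ℝ) ≤ (k : ℝ) + 1 := by
    have : k / 2 + 1 ≤ k + 1 := by omega
    exact_mod_cast this
  have h0 : 0 ≤ ((k + 1).factorial : ℝ) * (2 * R) ^ k := by positivity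
  nlinarith

/-- `|C_j^{(5/2)}(s)| ≤ (j+1) (j+2)! (2R)^j` for `|s| ≤ R`, `R ≥ 1`. [folklore] -/
theorem abs_gegenSix_le_of_abs_le (j : ℕ) {s R : ℝ} (hR : 1 ≤ R) (hs : |s| ≤ R) :
    |gegenSix j s| ≤ ((j : ℝ) + 1) * ((j + 2).factorial : ℝ) * (2 * R) ^ j := by
  unfold gegenSix
  refine (Finset.abs_sum_le_sum_abs _ _).trans ?_
  have hterm : ∀ l ∈ Finset.range (j / 2 + 1),
      |(-1 : ℝ) ^ l * (∏ i ∈ Finset.range (j - l), ((5 : ℝ) / 2 + (i : ℝ))) /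
        (((l.factorial : ℕ) : ℝ) * (((j - 2 * l).factorial : ℕ) : ℝ)) * (2 * s) ^ (j - 2 * l)|
        ≤ ((j + 2).factorial : ℝ) * (2 * R) ^ j := by
    intro l _
    rw [abs_mul, abs_div, abs_mul, abs_pow, abs_neg, abs_one, one_pow, one_mul,
      abs_of_nonneg (prod_fiveHalves_nonneg _), abs_pow,
      abs_of_pos (show (0 : ℝ) < ((l.factorial : ℕ) : ℝ) * (((j - 2 * l).factorial : ℕ) : ℝ) by
        positivity)]
    have hP : (∏ i ∈ Finset.range (j - l), ((5 : ℝ) / 2 + (i : ℝ))) ≤ ((j + 2).factorial : ℝ) :=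
      (prod_fiveHalves_le _).trans (by exact_mod_cast Nat.factorial_le (by omega))
    have hden : (1 : ℝ) ≤ ((l.factorial : ℕ) : ℝ) * (((j - 2 * l).factorial : ℕ) : ℝ) := by
      have h1 : (1 : ℝ) ≤ ((l.factorial : ℕ) : ℝ) := by exact_mod_cast Nat.factorial_pos l
      have h2 : (1 : ℝ) ≤ (((j - 2 * l).factorial : ℕ) : ℝ) := by exact_mod_cast Nat.factorial_pos _
      nlinarith
    have hpow : |2 * s| ^ (j - 2 * l) ≤ (2 * R) ^ j := by
      have h2s : |2 * s| ≤ 2 * R := by rw [abs_mul, abs_two]; linarith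
      calc |2 * s| ^ (j - 2 * l) ≤ (2 * R) ^ (j - 2 * l) :=
            pow_le_pow_left₀ (abs_nonneg _) h2s _
        _ ≤ (2 * R) ^ j := pow_le_pow_right₀ (by linarith) (by omega)
    calc (∏ i ∈ Finset.range (j - l), ((5 : ℝ) / 2 + (i : ℝ))) /
          (((l.factorial : ℕ) : ℝ) * (((j - 2 * l).factorial : ℕ) : ℝ)) * |2 * s| ^ (j - 2 * l)
        ≤ ((j + 2).factorial : ℝ) / 1 * (2 * R) ^ j := by
          refine mul_le_mul (div_le_div₀ (by positivity) hP one_pos hden) hpow (by positivity)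
            (by positivity)
      _ = ((j + 2).factorial : ℝ) * (2 * R) ^ j := by rw [div_one]
  refine (Finset.sum_le_sum hterm).trans ?_
  rw [Finset.sum_const, Finset.card_range, nsmul_eq_mul]
  have hj : ((j / 2 + 1 : ℕ) : ℝ) ≤ (j : ℝ) + 1 := by
    have : j / 2 + 1 ≤ j + 1 := by omega
    exact_mod_cast this
  have h0 : 0 ≤ ((j + 2).factorial : ℝ) * (2 * R) ^ j := by positivity
  nlinarith

/-! ### A summable majorant `e^{-k²τ} ((k+3)!)² c^k` -/

/-- The Gaussian factor wins: eventually `P (k+4)² e^{-(2k+1)τ} ≤ 1/2`. [folklore] -/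
theorem eventually_ratio_le_half {τ : ℝ} (hτ : 0 < τ) (P : ℝ) :
    ∀ᶠ k : ℕ in atTop, P * ((k : ℝ) + 4) ^ 2 * Real.exp (-((2 * (k : ℝ) + 1) * τ)) ≤ 1 / 2 := by
  rcases le_or_gt P 0 with hP | hP
  · refine Filter.Eventually.of_forall fun k => ?_
    have h1 : P * ((k : ℝ) + 4) ^ 2 ≤ 0 := mul_nonpos_of_nonpos_of_nonneg hP (sq_nonneg _)
    have h2 : P * ((k : ℝ) + 4) ^ 2 * Real.exp (-((2 * (k : ℝ) + 1) * τ)) ≤ 0 :=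
      mul_nonpos_of_nonpos_of_nonneg h1 (Real.exp_pos _).le
    linarith
  · obtain ⟨K, hK⟩ := exists_nat_gt (12 * P / τ ^ 3)
    filter_upwards [eventually_ge_atTop (max K 4)] with k hk
    have hk4 : (4 : ℝ) ≤ k := by exact_mod_cast le_of_max_le_right hk
    have hkK : (K : ℝ) ≤ k := by exact_mod_cast le_of_max_le_left hk
    have hτ3 : 0 < τ ^ 3 := by positivity
    have h1 : 12 * P < (K : ℝ) * τ ^ 3 := by rwa [div_lt_iff₀ hτ3] at hK
    have h3 : ((k : ℝ) + 4) ^ 2 ≤ (2 * (k : ℝ) + 1) ^ 2 :=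
      pow_le_pow_left₀ (by positivity) (by linarith) 2
    have h4 : 12 * P * ((k : ℝ) + 4) ^ 2 ≤ ((2 * (k : ℝ) + 1) * τ) ^ 3 :=
      calc 12 * P * ((k : ℝ) + 4) ^ 2 ≤ ((2 * (k : ℝ) + 1) * τ ^ 3) * (2 * (k : ℝ) + 1) ^ 2 :=
            mul_le_mul (by nlinarith) h3 (by positivity) (by positivity)
        _ = ((2 * (k : ℝ) + 1) * τ) ^ 3 := by ring
    have hx0 : 0 ≤ (2 * (k : ℝ) + 1) * τ := by positivity
    have hexp : ((2 * (k : ℝ) + 1) * τ) ^ 3 / 6 ≤ Real.exp ((2 * (k : ℝ) + 1) * τ) := by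
      have h := Real.pow_div_factorial_le_exp _ hx0 3
      have h6 : ((Nat.factorial 3 : ℕ) : ℝ) = 6 := by norm_num [Nat.factorial]
      rwa [h6] at h
    rw [Real.exp_neg, ← div_eq_mul_inv, div_le_iff₀ (Real.exp_pos _)]
    linarith

/-- For `τ > 0` and `c ≥ 0` the majorant `e^{-k²τ} ((k+3)!)² c^k` is summable (ratio test:
consecutive ratio `c (k+4)² e^{-(2k+1)τ} → 0`). [folklore] -/
theorem summable_majorant {τ : ℝ} (hτ : 0 < τ) {c : ℝ} (hc : 0 ≤ c) :
    Summable fun k : ℕ =>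
      Real.exp (-(k : ℝ) ^ 2 * τ) * (((k + 3).factorial : ℕ) : ℝ) ^ 2 * c ^ k := by
  refine summable_of_ratio_norm_eventually_le (r := 1 / 2) (by norm_num) ?_
  filter_upwards [eventually_ratio_le_half hτ c] with k hk
  rw [Real.norm_of_nonneg (by positivity), Real.norm_of_nonneg (by positivity)]
  have hfac : (((k + 1 + 3).factorial : ℕ) : ℝ) = ((k : ℝ) + 4) * (((k + 3).factorial : ℕ) : ℝ) := by
    rw [show k + 1 + 3 = (k + 3) + 1 by ring, Nat.factorial_succ]; push_cast; ring
  have hexp : Real.exp (-((k + 1 : ℕ) : ℝ) ^ 2 * τ) =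
      Real.exp (-((2 * (k : ℝ) + 1) * τ)) * Real.exp (-(k : ℝ) ^ 2 * τ) := by
    rw [← Real.exp_add]; push_cast; ring_nf
  calc Real.exp (-((k + 1 : ℕ) : ℝ) ^ 2 * τ) * (((k + 1 + 3).factorial : ℕ) : ℝ) ^ 2 * c ^ (k + 1)
      = (c * ((k : ℝ) + 4) ^ 2 * Real.exp (-((2 * (k : ℝ) + 1) * τ))) *
          (Real.exp (-(k : ℝ) ^ 2 * τ) * (((k + 3).factorial : ℕ) : ℝ) ^ 2 * c ^ k) := by
        rw [hexp, hfac, pow_succ]; ring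
    _ ≤ 1 / 2 * (Real.exp (-(k : ℝ) ^ 2 * τ) * (((k + 3).factorial : ℕ) : ℝ) ^ 2 * c ^ k) :=
        mul_le_mul_of_nonneg_right hk (by positivity)

/-- `((k+3)(k+2))² (k+1)! ≤ ((k+3)!)²` (as `(k+3)! = (k+3)(k+2)(k+1)!` and `1 ≤ (k+1)!`). [folklore] -/
theorem sq_mul_factorial_le_sq_factorial (k : ℕ) :
    (((k : ℝ) + 3) * ((k : ℝ) + 2)) ^ 2 * (((k + 1).factorial : ℕ) : ℝ) ≤
      (((k + 3).factorial : ℕ) : ℝ) ^ 2 := by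
  have hf : (((k + 3).factorial : ℕ) : ℝ) = ((k : ℝ) + 3) * ((k : ℝ) + 2) * (((k + 1).factorial : ℕ) : ℝ) := by
    rw [show k + 3 = (k + 1) + 1 + 1 by ring, Nat.factorial_succ, Nat.factorial_succ (k + 1)]
    push_cast; ring
  have h1 : (1 : ℝ) ≤ (((k + 1).factorial : ℕ) : ℝ) := by exact_mod_cast Nat.factorial_pos _
  rw [hf]
  have h0 : 0 ≤ (((k : ℝ) + 3) * ((k : ℝ) + 2)) ^ 2 * (((k + 1).factorial : ℕ) : ℝ) := by positivity
  nlinarith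

/-! ### Summability of the `S⁴` and `S⁶` series for every `τ > 0` -/

/-- Term bound for the `S⁴` series on `|s| ≤ R`: `|wt k τ · C_k(s)| ≤ e^{-k²τ} ((k+3)!)² (2R)^k`.
[folklore] -/
theorem norm_wt_mul_gegen_le {τ s R : ℝ} (hτ : 0 < τ) (hR : 1 ≤ R) (hs : |s| ≤ R) (k : ℕ) :
    ‖wt k τ * gegen k s‖ ≤
      Real.exp (-(k : ℝ) ^ 2 * τ) * (((k + 3).factorial : ℕ) : ℝ) ^ 2 * (2 * R) ^ k := by
  rw [Real.norm_eq_abs, abs_mul, abs_of_pos (wt_pos k τ), wt]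
  have hg := abs_gegen_le_of_abs_le k hR hs
  have he : Real.exp (-((k : ℝ) * ((k : ℝ) + 3)) * τ) ≤ Real.exp (-(k : ℝ) ^ 2 * τ) := by
    rw [Real.exp_le_exp]; nlinarith [mul_nonneg (Nat.cast_nonneg k : (0 : ℝ) ≤ k) hτ.le]
  have hpoly : (2 * (k : ℝ) + 3) / 3 * (((k : ℝ) + 1) * ((k + 1).factorial : ℝ)) ≤
      (((k + 3).factorial : ℕ) : ℝ) ^ 2 := by
    refine le_trans ?_ (sq_mul_factorial_le_sq_factorial k)
    rw [← mul_assoc]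
    refine mul_le_mul_of_nonneg_right ?_ (by positivity)
    nlinarith [sq_nonneg (k : ℝ), (Nat.cast_nonneg k : (0 : ℝ) ≤ k)]
  calc Real.exp (-((k : ℝ) * ((k : ℝ) + 3)) * τ) * ((2 * (k : ℝ) + 3) / 3) * |gegen k s|
      ≤ Real.exp (-(k : ℝ) ^ 2 * τ) * ((2 * (k : ℝ) + 3) / 3) *
          (((k : ℝ) + 1) * ((k + 1).factorial : ℝ) * (2 * R) ^ k) :=
        mul_le_mul (mul_le_mul_of_nonneg_right he (by positivity)) hg (abs_nonneg _) (by positivity)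
    _ = Real.exp (-(k : ℝ) ^ 2 * τ) *
          ((2 * (k : ℝ) + 3) / 3 * (((k : ℝ) + 1) * ((k + 1).factorial : ℝ))) * (2 * R) ^ k := by
        ring
    _ ≤ Real.exp (-(k : ℝ) ^ 2 * τ) * (((k + 3).factorial : ℕ) : ℝ) ^ 2 * (2 * R) ^ k :=
        mul_le_mul_of_nonneg_right (mul_le_mul_of_nonneg_left hpoly (Real.exp_pos _).le)
          (by positivity)

/-- **Summability of the `S⁴` zonal series for every `τ > 0` and every real `s`.** [folklore] -/
theorem summable_wt_mul_gegen {τ : ℝ} (hτ : 0 < τ) (s : ℝ) :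
    Summable fun k : ℕ => wt k τ * gegen k s := by
  have hR : 1 ≤ |s| + 1 := by linarith [abs_nonneg s]
  exact Summable.of_norm_bounded (summable_majorant hτ (by positivity))
    (norm_wt_mul_gegen_le hτ hR (by linarith) )

/-- Weighted bound `(2j+5) |C_j^{(5/2)}(s)| ≤ ((j+3)!)² (2R)^j` on `|s| ≤ R`. [folklore] -/
theorem weight_mul_abs_gegenSix_le {s R : ℝ} (hR : 1 ≤ R) (hs : |s| ≤ R) (j : ℕ) :
    (2 * (j : ℝ) + 5) * |gegenSix j s| ≤ (((j + 3).factorial : ℕ) : ℝ) ^ 2 * (2 * R) ^ j := by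
  have hg := abs_gegenSix_le_of_abs_le j hR hs
  have hfac : (((j + 2).factorial : ℕ) : ℝ) = ((j : ℝ) + 2) * (((j + 1).factorial : ℕ) : ℝ) := by
    rw [Nat.factorial_succ (j + 1)]; push_cast; ring
  have hpoly : (2 * (j : ℝ) + 5) * (((j : ℝ) + 1) * ((j + 2).factorial : ℝ)) ≤
      (((j + 3).factorial : ℕ) : ℝ) ^ 2 := by
    refine le_trans ?_ (sq_mul_factorial_le_sq_factorial j)
    rw [hfac]
    have h0 : (0 : ℝ) ≤ (((j + 1).factorial : ℕ) : ℝ) := by positivity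
    have h1 : (2 * (j : ℝ) + 5) * (((j : ℝ) + 1) * ((j : ℝ) + 2)) ≤
        (((j : ℝ) + 3) * ((j : ℝ) + 2)) ^ 2 := by
      nlinarith [sq_nonneg (j : ℝ), (Nat.cast_nonneg j : (0 : ℝ) ≤ j)]
    calc (2 * (j : ℝ) + 5) * (((j : ℝ) + 1) * (((j : ℝ) + 2) * (((j + 1).factorial : ℕ) : ℝ)))
        = (2 * (j : ℝ) + 5) * (((j : ℝ) + 1) * ((j : ℝ) + 2)) * (((j + 1).factorial : ℕ) : ℝ) := by
          ring
      _ ≤ (((j : ℝ) + 3) * ((j : ℝ) + 2)) ^ 2 * (((j + 1).factorial : ℕ) : ℝ) :=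
        mul_le_mul_of_nonneg_right h1 h0
  calc (2 * (j : ℝ) + 5) * |gegenSix j s|
      ≤ (2 * (j : ℝ) + 5) * (((j : ℝ) + 1) * ((j + 2).factorial : ℝ) * (2 * R) ^ j) :=
        mul_le_mul_of_nonneg_left hg (by positivity)
    _ = (2 * (j : ℝ) + 5) * (((j : ℝ) + 1) * ((j + 2).factorial : ℝ)) * (2 * R) ^ j := by ring
    _ ≤ (((j + 3).factorial : ℕ) : ℝ) ^ 2 * (2 * R) ^ j :=
        mul_le_mul_of_nonneg_right hpoly (by positivity)

/-- `3 · wt (j+1) τ = 5 e^{-4τ} · wtSix j τ` (`(j+1)(j+4) = j(j+5) + 4`, `2(j+1)+3 = 2j+5`). [folklore] -/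
theorem wt_succ_mul_three (j : ℕ) (τ : ℝ) :
    wt (j + 1) τ * 3 = 5 * Real.exp (-4 * τ) * wtSix j τ := by
  unfold wt wtSix
  have h : Real.exp (-(((j + 1 : ℕ) : ℝ) * (((j + 1 : ℕ) : ℝ) + 3)) * τ) =
      Real.exp (-4 * τ) * Real.exp (-((j : ℝ) * ((j : ℝ) + 5)) * τ) := by
    rw [← Real.exp_add]; push_cast; ring_nf
  rw [h]; push_cast; ring

/-- Term bound for the derivative series on `|s| ≤ R`:
`|wt (j+1) τ · 3 C_j^{(5/2)}(s)| ≤ e^{-j²τ} ((j+3)!)² (2R)^j`. [folklore] -/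
theorem norm_wt_succ_mul_gegenSix_le {τ s R : ℝ} (hτ : 0 < τ) (hR : 1 ≤ R) (hs : |s| ≤ R)
    (j : ℕ) :
    ‖wt (j + 1) τ * (3 * gegenSix j s)‖ ≤
      Real.exp (-(j : ℝ) ^ 2 * τ) * (((j + 3).factorial : ℕ) : ℝ) ^ 2 * (2 * R) ^ j := by
  rw [Real.norm_eq_abs, abs_mul, abs_mul, abs_of_pos (wt_pos _ τ), wt,
    abs_of_pos (by norm_num : (0 : ℝ) < 3)]
  have hg := weight_mul_abs_gegenSix_le hR hs j
  have he : Real.exp (-(((j + 1 : ℕ) : ℝ) * (((j + 1 : ℕ) : ℝ) + 3)) * τ) ≤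
      Real.exp (-(j : ℝ) ^ 2 * τ) := by
    rw [Real.exp_le_exp]; push_cast
    nlinarith [mul_nonneg (Nat.cast_nonneg j : (0 : ℝ) ≤ j) hτ.le]
  have h3 : (2 * ((j + 1 : ℕ) : ℝ) + 3) / 3 * 3 = 2 * (j : ℝ) + 5 := by push_cast; ring
  calc Real.exp (-(((j + 1 : ℕ) : ℝ) * (((j + 1 : ℕ) : ℝ) + 3)) * τ) *
        ((2 * ((j + 1 : ℕ) : ℝ) + 3) / 3) * (3 * |gegenSix j s|)
      = Real.exp (-(((j + 1 : ℕ) : ℝ) * (((j + 1 : ℕ) : ℝ) + 3)) * τ) *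
          ((2 * (j : ℝ) + 5) * |gegenSix j s|) := by rw [← h3]; ring
    _ ≤ Real.exp (-(j : ℝ) ^ 2 * τ) * ((((j + 3).factorial : ℕ) : ℝ) ^ 2 * (2 * R) ^ j) :=
        mul_le_mul he hg (by positivity) (by positivity)
    _ = _ := by ring

/-- Term bound for the `S⁶` series on `|s| ≤ R`:
`|wtSix j τ · C_j^{(5/2)}(s)| ≤ e^{-j²τ} ((j+3)!)² (2R)^j`. [folklore] -/
theorem norm_wtSix_mul_gegenSix_le {τ s R : ℝ} (hτ : 0 < τ) (hR : 1 ≤ R) (hs : |s| ≤ R)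
    (j : ℕ) :
    ‖wtSix j τ * gegenSix j s‖ ≤
      Real.exp (-(j : ℝ) ^ 2 * τ) * (((j + 3).factorial : ℕ) : ℝ) ^ 2 * (2 * R) ^ j := by
  rw [Real.norm_eq_abs, abs_mul, abs_of_pos (wtSix_pos j τ), wtSix]
  have hg := weight_mul_abs_gegenSix_le hR hs j
  have he : Real.exp (-((j : ℝ) * ((j : ℝ) + 5)) * τ) ≤ Real.exp (-(j : ℝ) ^ 2 * τ) := by
    rw [Real.exp_le_exp]
    nlinarith [mul_nonneg (Nat.cast_nonneg j : (0 : ℝ) ≤ j) hτ.le]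
  have h5 : (2 * (j : ℝ) + 5) / 5 * |gegenSix j s| ≤ (2 * (j : ℝ) + 5) * |gegenSix j s| := by
    have h0 : 0 ≤ (2 * (j : ℝ) + 5) * |gegenSix j s| := by positivity
    nlinarith
  calc Real.exp (-((j : ℝ) * ((j : ℝ) + 5)) * τ) * ((2 * (j : ℝ) + 5) / 5) * |gegenSix j s|
      = Real.exp (-((j : ℝ) * ((j : ℝ) + 5)) * τ) * ((2 * (j : ℝ) + 5) / 5 * |gegenSix j s|) := by
        ring
    _ ≤ Real.exp (-(j : ℝ) ^ 2 * τ) * ((((j + 3).factorial : ℕ) : ℝ) ^ 2 * (2 * R) ^ j) :=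
        mul_le_mul he (h5.trans hg) (by positivity) (by positivity)
    _ = _ := by ring

/-- **Summability of the `S⁶` zonal series for every `τ > 0` and every real `s`.** [folklore] -/
theorem summable_wtSix_mul_gegenSix {τ : ℝ} (hτ : 0 < τ) (s : ℝ) :
    Summable fun j : ℕ => wtSix j τ * gegenSix j s := by
  have hR : 1 ≤ |s| + 1 := by linarith [abs_nonneg s]
  exact Summable.of_norm_bounded (summable_majorant hτ (by positivity))
    (norm_wtSix_mul_gegenSix_le hτ hR (by linarith))

end Literature.Geometry.Riemannian.SphericalZonalKernelSeries
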